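import Summits.NavierStokesRegularity.NavierStokesRegularity.Theorems.CoriolisHeadTypeIRateReduction
import HarnessLib

/-!
# CoriolisHeadTypeIRateDyadicTransport — crux `NoCoRotatingCore` (stmt-NavierStokesRegularity-22676), line
# `far_field_constancy` v2 (skeleton 15c9a82ad206abb9), stub K1c `stub_typeIRate`:
# spiral transport chained over dyadic shells (critical forcing with a summable dyadic profile)

The third door to K1c (memo K1C-REDUCTION-v4 §"third door"): if the critical forcing `Φ/‖y‖` of the spiral transport
has a DYADIC PROFILE `Φ_j` on the shells `R2^j ≤ ‖y‖ ≤ R2^{j+1}` with bounded partial sums `Σ_{j<n} Φ_j ≤ Φ_s`, the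
logarithm of `CoriolisHeadTypeIRateLogTransport` disappears: `‖y‖‖W(y)‖ ≤ Rm + 2D/(aR) + (2/a)Σ_{j<n}Φ_j`
(`norm_mul_norm_le_of_transport_dyadic`, by chaining the landed one-shell estimate `norm_mul_norm_le_of_transport`
shell by shell — on shell `j` the critical term `Φ_j/‖z‖ ≤ Φ_j R2^{j+1}/‖z‖²` is subcritical), and with a linear term
`κ‖W‖/‖y‖`, `κ ≤ aR/4`, absorbed by the shell-maximum bootstrap: `‖y‖‖W(y)‖ ≤ 2(Rm + 2D/(aR) + 2Φ_s/a)`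
(`norm_mul_norm_le_of_transport_linear_dyadic`, `…_shift`).  This is the transport half of «K1c ⇐ K1a with a
square-summable dyadic modulus»; the pressure half (a dyadic profile for `‖∇P − g‖`) is NOT in the tree yet.
Elementary; nothing here proves K1c, `NoCoRotatingCore` or NS regularity.

References: line card `Cruxes/NoCoRotatingCore/Lines/far_field_constancy.md` (K1c block); B. Pineau, V. Vicol,
arXiv:2607.09619 (2026), (1.8) [PineauVicol2026].
-/

noncomputable section

open Set Function Filter Topology Metric InnerProductSpace Real
open scoped RealInnerProductSpace BigOperators

-- the summit and its single sub-problem share the name (CONVENTIONS §1), as in every Theorems file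
set_option linter.dupNamespace false

namespace Summit.NavierStokesRegularity.NavierStokesRegularity.Theorems.CoriolisHead

namespace TypeIRate

open Literature.Analysis.FluidPDE

/-! ## §1 Chaining the one-shell estimate -/

/-- **Spiral transport chained over dyadic shells.**  Let `a > 0`, `B` skew, `W ∈ C¹(ℝ³; ℝ³)` with `‖W‖ ≤ m` on the
sphere `‖y‖ = R` (`R > 0`), and suppose that on each dyadic shell `R2^j ≤ ‖y‖ ≤ R2^{j+1}` (below the ceiling `ρ`) the
transport expression obeys `‖DW·(ay − By) + aW + BW‖ ≤ D/‖y‖² + Φ_j/‖y‖` with `Φ_j ≥ 0`.  Then for `R ≤ ‖y‖ ≤ R2^n`,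
`‖y‖ ≤ ρ`: `‖y‖‖W(y)‖ ≤ Rm + (D/(aR))Σ_{j<n}2^{−j} + (2/a)Σ_{j<n}Φ_j`.  Induction on `n` with the landed one-shell
estimate `norm_mul_norm_le_of_transport` on `[R2^n, ‖y‖]` (`δ = 1`, the critical term put in the `1/‖z‖²` slot as
`Φ_n R2^{n+1}/‖z‖²`, sphere datum from the induction hypothesis). [folklore] -/
theorem norm_mul_norm_le_of_transport_dyadic {a : ℝ} (ha : 0 < a)
    {B : EuclideanSpace ℝ (Fin 3) →L[ℝ] EuclideanSpace ℝ (Fin 3)} (hB : ∀ x, inner ℝ (B x) x = 0)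
    {W : EuclideanSpace ℝ (Fin 3) → EuclideanSpace ℝ (Fin 3)} (hW : Differentiable ℝ W)
    {R ρ D m : ℝ} (hR : 0 < R) (hD : 0 ≤ D) {Φ : ℕ → ℝ} (hΦ : ∀ j, 0 ≤ Φ j)
    (hm : ∀ y : EuclideanSpace ℝ (Fin 3), ‖y‖ = R → ‖W y‖ ≤ m)
    (hG : ∀ (j : ℕ) (y : EuclideanSpace ℝ (Fin 3)), R * 2 ^ j ≤ ‖y‖ → ‖y‖ ≤ R * 2 ^ (j + 1) → ‖y‖ ≤ ρ →
      ‖fderiv ℝ W y (a • y - B y) + (a • W y + B (W y))‖ ≤ D / ‖y‖ ^ 2 + Φ j / ‖y‖) :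
    ∀ (n : ℕ) (y : EuclideanSpace ℝ (Fin 3)), R ≤ ‖y‖ → ‖y‖ ≤ R * 2 ^ n → ‖y‖ ≤ ρ →
      ‖y‖ * ‖W y‖ ≤ R * m + D / (a * R) * (∑ j ∈ Finset.range n, (1 / 2 : ℝ) ^ j) +
        2 / a * ∑ j ∈ Finset.range n, Φ j := by
  have hm0 : 0 ≤ m := by
    obtain ⟨y₀, hy₀⟩ := exists_norm_eq (EuclideanSpace ℝ (Fin 3)) hR.le
    exact (norm_nonneg _).trans (hm y₀ hy₀)
  intro n
  induction n with
  | zero =>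
    intro y hy1 hy2 _
    rw [pow_zero, mul_one] at hy2
    have hyR : ‖y‖ = R := le_antisymm hy2 hy1
    simp only [Finset.range_zero, Finset.sum_empty, mul_zero, add_zero]
    rw [hyR]
    exact mul_le_mul_of_nonneg_left (hm y hyR) hR.le
  | succ n ih =>
    intro y hy1 hy2 hyρ
    -- the invariant at level `n`
    set S : ℝ := R * m + D / (a * R) * (∑ j ∈ Finset.range n, (1 / 2 : ℝ) ^ j) +
      2 / a * ∑ j ∈ Finset.range n, Φ j with hS
    have hSn : S + D / (a * R) * (1 / 2 : ℝ) ^ n + 2 / a * Φ n =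
        R * m + D / (a * R) * (∑ j ∈ Finset.range (n + 1), (1 / 2 : ℝ) ^ j) +
          2 / a * ∑ j ∈ Finset.range (n + 1), Φ j := by
      rw [Finset.sum_range_succ, Finset.sum_range_succ, hS]; ring
    rw [← hSn]
    have hstep0 : 0 ≤ D / (a * R) * (1 / 2 : ℝ) ^ n + 2 / a * Φ n := by
      have := hΦ n; positivity
    by_cases hlow : ‖y‖ ≤ R * 2 ^ n
    · have h := ih y hy1 hlow hyρ
      linarith
    rw [not_le] at hlow
    -- the shell `[R 2^n, ‖y‖]`
    have hRn : 0 < R * 2 ^ n := by positivity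
    have hm' : ∀ z : EuclideanSpace ℝ (Fin 3), ‖z‖ = R * 2 ^ n → ‖W z‖ ≤ S / (R * 2 ^ n) := by
      intro z hz
      have h := ih z (by rw [hz]; exact le_mul_of_one_le_right hR.le (one_le_pow₀ one_le_two)) hz.le
        (by rw [hz]; exact hlow.le.trans hyρ)
      rw [le_div_iff₀ hRn, mul_comm, ← hz]
      exact h
    have hG' : ∀ z : EuclideanSpace ℝ (Fin 3), R * 2 ^ n ≤ ‖z‖ → ‖z‖ ≤ ‖y‖ →
        ‖fderiv ℝ W z (a • z - B z) + (a • W z + B (W z))‖ ≤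
          (D + Φ n * (R * 2 ^ (n + 1))) / ‖z‖ ^ 2 + 0 / ‖z‖ ^ (1 + (1 : ℝ)) := by
      intro z hz1 hz2
      have hzpos : 0 < ‖z‖ := hRn.trans_le hz1
      have hz3 : ‖z‖ ≤ R * 2 ^ (n + 1) := hz2.trans hy2
      refine (hG n z hz1 hz3 (hz2.trans hyρ)).trans ?_
      rw [zero_div, add_zero, add_div]
      refine add_le_add le_rfl ?_
      rw [div_le_div_iff₀ hzpos (pow_pos hzpos 2)]
      have h := mul_le_mul_of_nonneg_left hz3 (hΦ n)
      nlinarith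
    have hkey := norm_mul_norm_le_of_transport ha hB hW hRn one_pos
      (by have := hΦ n; positivity : 0 ≤ D + Φ n * (R * 2 ^ (n + 1))) le_rfl hm' hG' hlow.le le_rfl
    have e1 : R * 2 ^ n * (S / (R * 2 ^ n)) = S := by field_simp
    have e2 : (D + Φ n * (R * 2 ^ (n + 1))) / (a * (R * 2 ^ n)) =
        D / (a * R) * (1 / 2 : ℝ) ^ n + 2 / a * Φ n := by
      rw [pow_succ, one_div_pow]; field_simp
    rw [e1, e2, zero_div, add_zero] at hkey
    linarith

/-! ## §2 Absorbing a linear term -/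

/-- **Type-I rate from the dyadic transport structure.**  Let `a > 0`, `B` skew, `W ∈ C¹(ℝ³; ℝ³)` bounded (`‖W‖ ≤ m`),
`R > 0`, `0 ≤ κ ≤ aR/4`, `Φ_j ≥ 0` with bounded partial sums `Σ_{j<n}Φ_j ≤ Φ_s`, and suppose that on each dyadic shell
`R2^j ≤ ‖y‖ ≤ R2^{j+1}` the transport expression obeys `‖DW·(ay − By) + aW + BW‖ ≤ κ‖W(y)‖/‖y‖ + D/‖y‖² + Φ_j/‖y‖`.
Then `‖y‖‖W(y)‖ ≤ 2(Rm + 2D/(aR) + 2Φ_s/a)` beyond `R`: the maximum `Q` of `‖z‖‖W(z)‖` on `R ≤ ‖z‖ ≤ ‖y‖` turns the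
linear term into `κQ/‖z‖²`, `norm_mul_norm_le_of_transport_dyadic` bounds `Q`, and `2κ/(aR) ≤ ½` absorbs. [folklore] -/
theorem norm_mul_norm_le_of_transport_linear_dyadic {a : ℝ} (ha : 0 < a)
    {B : EuclideanSpace ℝ (Fin 3) →L[ℝ] EuclideanSpace ℝ (Fin 3)} (hB : ∀ x, inner ℝ (B x) x = 0)
    {W : EuclideanSpace ℝ (Fin 3) → EuclideanSpace ℝ (Fin 3)} (hW : Differentiable ℝ W)
    {R κ D m Φs : ℝ} (hR : 0 < R) (hκ : 0 ≤ κ) (hκR : κ ≤ a * R / 4) (hD : 0 ≤ D)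
    {Φ : ℕ → ℝ} (hΦ : ∀ j, 0 ≤ Φ j) (hΦs : ∀ n, ∑ j ∈ Finset.range n, Φ j ≤ Φs)
    (hm : ∀ y : EuclideanSpace ℝ (Fin 3), ‖W y‖ ≤ m)
    (hG : ∀ (j : ℕ) (y : EuclideanSpace ℝ (Fin 3)), R * 2 ^ j ≤ ‖y‖ → ‖y‖ ≤ R * 2 ^ (j + 1) →
      ‖fderiv ℝ W y (a • y - B y) + (a • W y + B (W y))‖ ≤
        κ * ‖W y‖ / ‖y‖ + D / ‖y‖ ^ 2 + Φ j / ‖y‖)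
    (y : EuclideanSpace ℝ (Fin 3)) (hy : R ≤ ‖y‖) :
    ‖y‖ * ‖W y‖ ≤ 2 * (R * m + 2 * D / (a * R) + 2 * Φs / a) := by
  -- the shell `R ≤ ‖z‖ ≤ ‖y‖` and the maximum of `‖z‖ ‖W z‖` on it
  set S : Set (EuclideanSpace ℝ (Fin 3)) := {z | R ≤ ‖z‖ ∧ ‖z‖ ≤ ‖y‖} with hS
  have hSc : IsCompact S := by
    refine (isCompact_closedBall (0 : EuclideanSpace ℝ (Fin 3)) ‖y‖).of_isClosed_subset ?_ ?_
    · exact (isClosed_le continuous_const continuous_norm).inter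
        (isClosed_le continuous_norm continuous_const)
    · intro z hz
      exact mem_closedBall_zero_iff.2 hz.2
  have hyS : y ∈ S := ⟨hy, le_rfl⟩
  have hfc : Continuous fun z : EuclideanSpace ℝ (Fin 3) => ‖z‖ * ‖W z‖ :=
    continuous_norm.mul hW.continuous.norm
  obtain ⟨z₀, hz₀S, hmax⟩ := hSc.exists_isMaxOn ⟨y, hyS⟩ hfc.continuousOn
  set Q : ℝ := ‖z₀‖ * ‖W z₀‖ with hQ
  have hQ0 : 0 ≤ Q := by positivity
  have hQmax : ∀ z ∈ S, ‖z‖ * ‖W z‖ ≤ Q := fun z hz => hmax hz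
  have hm0 : 0 ≤ m := (norm_nonneg _).trans (hm 0)
  have hΦs0 : 0 ≤ Φs := le_trans (by simp) (hΦs 0)
  -- a dyadic level above `‖y‖`
  obtain ⟨n, hn⟩ := pow_unbounded_of_one_lt (‖y‖ / R) (one_lt_two : (1 : ℝ) < 2)
  have hyn : ‖y‖ ≤ R * 2 ^ n := by
    rw [div_lt_iff₀ hR] at hn
    linarith
  -- on the shell the linear term is a `1/‖z‖²` forcing
  have hG' : ∀ (j : ℕ) (z : EuclideanSpace ℝ (Fin 3)), R * 2 ^ j ≤ ‖z‖ → ‖z‖ ≤ R * 2 ^ (j + 1) → ‖z‖ ≤ ‖y‖ →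
      ‖fderiv ℝ W z (a • z - B z) + (a • W z + B (W z))‖ ≤ (κ * Q + D) / ‖z‖ ^ 2 + Φ j / ‖z‖ := by
    intro j z hz1 hz2 hz3
    have hRz : R ≤ ‖z‖ := (le_mul_of_one_le_right hR.le (one_le_pow₀ one_le_two)).trans hz1
    have hzpos : 0 < ‖z‖ := hR.trans_le hRz
    have h1 : κ * ‖W z‖ / ‖z‖ ≤ κ * Q / ‖z‖ ^ 2 := by
      rw [div_le_div_iff₀ hzpos (pow_pos hzpos 2)]
      have h := mul_le_mul_of_nonneg_left (hQmax z ⟨hRz, hz3⟩) hκ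
      nlinarith
    calc ‖fderiv ℝ W z (a • z - B z) + (a • W z + B (W z))‖
        ≤ κ * ‖W z‖ / ‖z‖ + D / ‖z‖ ^ 2 + Φ j / ‖z‖ := hG j z hz1 hz2
      _ ≤ κ * Q / ‖z‖ ^ 2 + D / ‖z‖ ^ 2 + Φ j / ‖z‖ := by linarith
      _ = (κ * Q + D) / ‖z‖ ^ 2 + Φ j / ‖z‖ := by rw [add_div]
  -- the chained estimate at the maximum point
  have hkey := norm_mul_norm_le_of_transport_dyadic ha hB hW hR (by positivity : 0 ≤ κ * Q + D) hΦ
    (fun z _ => hm z) hG' n z₀ hz₀S.1 (hz₀S.2.trans hyn) hz₀S.2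
  -- geometric sum ≤ 2, partial sum ≤ Φs
  have hgeom : ∑ j ∈ Finset.range n, (1 / 2 : ℝ) ^ j ≤ 2 := by
    have h := geom_sum_Ico_le_of_lt_one (x := (1 / 2 : ℝ)) (m := 0) (n := n) (by norm_num) (by norm_num)
    rw [← Finset.range_eq_Ico] at h
    refine h.trans (le_of_eq ?_)
    norm_num
  have hsum := hΦs n
  have h1 : (κ * Q + D) / (a * R) * (∑ j ∈ Finset.range n, (1 / 2 : ℝ) ^ j) ≤ (κ * Q + D) / (a * R) * 2 :=
    mul_le_mul_of_nonneg_left hgeom (by positivity)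
  have h2 : 2 / a * ∑ j ∈ Finset.range n, Φ j ≤ 2 / a * Φs := mul_le_mul_of_nonneg_left hsum (by positivity)
  -- absorb
  have habs : (κ * Q + D) / (a * R) * 2 ≤ Q / 2 + 2 * D / (a * R) := by
    rw [add_div, add_mul]
    have h3 : κ * Q / (a * R) * 2 ≤ Q / 2 := by
      rw [div_mul_eq_mul_div, div_le_div_iff₀ (by positivity) two_pos]
      have := mul_le_mul_of_nonneg_right hκR hQ0
      nlinarith
    have h4 : D / (a * R) * 2 = 2 * D / (a * R) := by ring
    linarith
  have hQle : Q ≤ 2 * (R * m + 2 * D / (a * R) + 2 * Φs / a) := by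
    have : Q ≤ R * m + (Q / 2 + 2 * D / (a * R)) + 2 / a * Φs := by
      calc Q = ‖z₀‖ * ‖W z₀‖ := hQ
        _ ≤ R * m + (κ * Q + D) / (a * R) * (∑ j ∈ Finset.range n, (1 / 2 : ℝ) ^ j) +
              2 / a * ∑ j ∈ Finset.range n, Φ j := hkey
        _ ≤ R * m + (Q / 2 + 2 * D / (a * R)) + 2 / a * Φs := by linarith
    have e : 2 / a * Φs = 2 * Φs / a := by ring
    linarith
  exact (hQmax y hyS).trans hQle

/-- **The same with a shifted centre** `c` (spiral characteristics of `V(y) = a(y − c) − B(y − c)`; dyadic shells in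
`‖y − c‖`). [folklore] -/
theorem norm_mul_norm_le_of_transport_linear_dyadic_shift {a : ℝ} (ha : 0 < a)
    {B : EuclideanSpace ℝ (Fin 3) →L[ℝ] EuclideanSpace ℝ (Fin 3)} (hB : ∀ x, inner ℝ (B x) x = 0)
    {W : EuclideanSpace ℝ (Fin 3) → EuclideanSpace ℝ (Fin 3)} (hW : Differentiable ℝ W)
    (c : EuclideanSpace ℝ (Fin 3))
    {R κ D m Φs : ℝ} (hR : 0 < R) (hκ : 0 ≤ κ) (hκR : κ ≤ a * R / 4) (hD : 0 ≤ D)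
    {Φ : ℕ → ℝ} (hΦ : ∀ j, 0 ≤ Φ j) (hΦs : ∀ n, ∑ j ∈ Finset.range n, Φ j ≤ Φs)
    (hm : ∀ y : EuclideanSpace ℝ (Fin 3), ‖W y‖ ≤ m)
    (hG : ∀ (j : ℕ) (y : EuclideanSpace ℝ (Fin 3)), R * 2 ^ j ≤ ‖y - c‖ → ‖y - c‖ ≤ R * 2 ^ (j + 1) →
      ‖fderiv ℝ W y (a • (y - c) - B (y - c)) + (a • W y + B (W y))‖ ≤
        κ * ‖W y‖ / ‖y - c‖ + D / ‖y - c‖ ^ 2 + Φ j / ‖y - c‖)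
    (y : EuclideanSpace ℝ (Fin 3)) (hy : R ≤ ‖y - c‖) :
    ‖y - c‖ * ‖W y‖ ≤ 2 * (R * m + 2 * D / (a * R) + 2 * Φs / a) := by
  set W' : EuclideanSpace ℝ (Fin 3) → EuclideanSpace ℝ (Fin 3) := fun z => W (z + c) with hW'
  have hW'd : Differentiable ℝ W' := hW.comp (differentiable_id.add_const c)
  have hfd : ∀ z, fderiv ℝ W' z = fderiv ℝ W (z + c) := fun z => by
    rw [hW']
    exact fderiv_comp_add_right c
  have hm' : ∀ z : EuclideanSpace ℝ (Fin 3), ‖W' z‖ ≤ m := fun z => hm (z + c)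
  have hG'' : ∀ (j : ℕ) (z : EuclideanSpace ℝ (Fin 3)), R * 2 ^ j ≤ ‖z‖ → ‖z‖ ≤ R * 2 ^ (j + 1) →
      ‖fderiv ℝ W' z (a • z - B z) + (a • W' z + B (W' z))‖ ≤
        κ * ‖W' z‖ / ‖z‖ + D / ‖z‖ ^ 2 + Φ j / ‖z‖ := by
    intro j z hz1 hz2
    have h := hG j (z + c) (by rwa [add_sub_cancel_right]) (by rwa [add_sub_cancel_right])
    rw [add_sub_cancel_right] at h
    rw [hfd]
    exact h
  have h := norm_mul_norm_le_of_transport_linear_dyadic ha hB hW'd hR hκ hκR hD hΦ hΦs hm' hG'' (y - c) hy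
  simpa only [hW', sub_add_cancel] using h

end TypeIRate

end Summit.NavierStokesRegularity.NavierStokesRegularity.Theorems.CoriolisHead

end
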